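import Mathlib

/-!
# T⁴ programme, node NE3 (η-rate of the minimisers), route P3 — leaf L8 (abstract part): COMBES–THOMAS LOCALITY
# FROM A GAP, in FORM language: a coercive operator conjugated by a weight stays coercive when the conjugation
# defect is form-small; hence weighted bounds for solutions of `H u = f` and for the correction maps built from `H⁻¹`

First generation of the NE3 prover lineage P3 of the cell `pub-balaban` (unit `b2b-balaban-t4-ne3-p3`; co-owner #3
of `BINDER-OWNERS.md` row NE3, ROUND-2 SKELETON-FIRST mandate).  Skeleton `HOME/t4/skeletons/NE3-t4-ne3-p3.md`
(v1 71d0aef383766d71), leaf L8 (c): the two tangent corrections of the route's local step (the constraint correction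
through `(Q_U Q_U*)⁻¹` and the gauge correction through the block-mean-zero covariant scalar Laplacian
`R D*_U D_U R*`) are inverses of EXPLICIT GAPPED operators; their exponential locality — the numbers θ₁, κ₂ of the
tree's `T4ConstrainedAgmon.agmon_constrained_tangent` ∕ this route's `NE3SegmentRSI.agmon_segment` — follows from the
gap by the Combes–Thomas argument: conjugate by the weight `W = e^{μρ}`, control the conjugation defect of `H` in
the FORM sense (for a second-order difference operator and a unit-scale 1-Lipschitz `ρ` the defect is
`≤ a‖x‖² + b⟨x, Hx⟩` with `a, b = O(μ)`, uniformly in the mesh), conclude coercivity of `W H W⁻¹`, and read off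
`‖W u‖ ≤ ‖W f‖ ∕ c` for `H u = f`.  The route's sibling P2 carries the corresponding inputs as printed-TYPE decay of
the kernels of `H_W`, `(QGQ*)⁻¹`, `𝔇_W` ([Balaban1985BackgroundPropagators] (3.132)–(3.133)); here they are a GENERAL
THEOREM about gapped operators (published template: J.-M. Combes & L. Thomas, Commun. Math. Phys. 34 (1973) 251–270;
lattice form: V. Chulaevsky & Y. Suhov, *Multi-scale Analysis for Random Quantum Systems with Interaction*,
Birkhäuser 2014, Thm 2.3.3 (2.80) «dist[E, σ(H_Λ(ω))] ≥ η > 0 ⟹ |G_Λ(x, y; E, ω)| ≤ (2∕η) exp(−(η∕5d)|x − y|)»).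
The tree's `T4ConvexResponse.local_response_decay` (p185646) is the Neumann∕Richardson version, adequate only when
the spectral width Λ∕m is O(1) (its own docstring: «NOT uniform in η for the fine-lattice Hessian»); the form
version below has no Λ and is the one the fine-lattice gauge correction needs.

WHAT IS PROVED ([folklore] linear algebra over a real inner-product space; no lattice, no Bałaban object):
§1 `coercive_conj_of_formDefect`: `m‖x‖² ≤ ⟨x, Hx⟩` and `|⟨x, (H′ − H) x⟩| ≤ a‖x‖² + b⟨x, Hx⟩` (`b ≤ 1`) ⟹
   `((1 − b) m − a)‖x‖² ≤ ⟨x, H′ x⟩` (apply with `H′ = W H W⁻¹`);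
§2 `norm_le_of_coercive_eq` (Lax–Milgram read-out): `c‖x‖² ≤ ⟨x, H′ x⟩`, `H′ x = g` ⟹ `‖x‖ ≤ ‖g‖ ∕ c`;
   `weighted_solution_bound`: `H u = f`, `W` invertible, `W H W⁻¹` c-coercive ⟹ `‖W u‖ ≤ ‖W f‖ ∕ c` (Combes–Thomas);
§3 `weighted_correction_bound`: for a correction map `corr = S ∘ H⁻¹ ∘ K` (dictionary: `S = D_U R*` or `Q_U*`,
   `K = R D*_U` or `Q_U` applied to a commutator `[·, ω]`), weighted operator bounds of `S`, `K` and the weighted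
   solution bound give `‖W (corr v)‖ ≤ C_S C_K ∕ c · ‖W′ v‖`-type estimates — the shape of θ₁, κ₂;
§4 non-vacuity on `ℝ`.

HONEST FRAMING.  Finite-T⁴ ultraviolet bookkeeping (rung (B)+1 of the cell's ladder); NOTHING is asserted about
Bałaban's operators (which `H`, `W`, `S`, `K` are is the swarm's instantiation rows Y8a∕b of the skeleton); no
conditional of the cell (`BetaPertH`, (B), (B^μ)) is used or hidden; NOT infinite volume, NOT a mass gap, NOT Clay,
NOT summit progress.  ABSOLUTE RULE of the cell kept: no printed sentence is a hypothesis of any declaration.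
PLACEMENT (human rule 2026-08-19): our lemmas under `Summits/QuantumFields/BalabanUV/`; imports Mathlib only.
-/

set_option autoImplicit false

namespace Summit.QuantumFields.BalabanUV.T4Continuum.NE3ProjectorLocality

open RealInnerProductSpace

noncomputable section

variable {V : Type*} [NormedAddCommGroup V] [InnerProductSpace ℝ V]

/-! ## §1 Conjugated coercivity from a gap and a form-small conjugation defect -/

/-- **COERCIVITY SURVIVES A FORM-SMALL PERTURBATION.**  If `H` has the gap `m‖x‖² ≤ ⟨x, Hx⟩` and `H′` differs from
`H` by a form-small amount, `|⟨x, (H′ − H)x⟩| ≤ a‖x‖² + b⟨x, Hx⟩` with `b ≤ 1`, then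
`((1 − b)m − a)‖x‖² ≤ ⟨x, H′x⟩`.  Dictionary: `H′ = W H W⁻¹` (conjugation by the Agmon weight), `a, b = O(μ)`.
[folklore] (Combes–Thomas mechanism, form version) -/
theorem coercive_conj_of_formDefect (H H' : V →ₗ[ℝ] V) {m a b : ℝ} (hb1 : b ≤ 1)
    (hgap : ∀ x, m * ‖x‖ ^ 2 ≤ ⟪x, H x⟫)
    (hdef : ∀ x, |⟪x, H' x⟫ - ⟪x, H x⟫| ≤ a * ‖x‖ ^ 2 + b * ⟪x, H x⟫) (x : V) :
    ((1 - b) * m - a) * ‖x‖ ^ 2 ≤ ⟪x, H' x⟫ := by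
  have h1 := hdef x
  have h2 := hgap x
  have h3 : -(a * ‖x‖ ^ 2 + b * ⟪x, H x⟫) ≤ ⟪x, H' x⟫ - ⟪x, H x⟫ := (abs_le.mp h1).1
  -- ⟪x,H'x⟫ ≥ (1-b)⟪x,Hx⟫ - a‖x‖² ≥ (1-b) m ‖x‖² - a ‖x‖²
  have h4 : (1 - b) * (m * ‖x‖ ^ 2) ≤ (1 - b) * ⟪x, H x⟫ :=
    mul_le_mul_of_nonneg_left h2 (by linarith)
  nlinarith

/-! ## §2 Lax–Milgram read-out and the weighted solution bound -/

/-- If `H′` is `c`-coercive (`c > 0`) and `H′ x = g`, then `‖x‖ ≤ ‖g‖ ∕ c`. [folklore] -/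
theorem norm_le_of_coercive_eq (H' : V →ₗ[ℝ] V) {c : ℝ} (hc : 0 < c)
    (hcoer : ∀ x, c * ‖x‖ ^ 2 ≤ ⟪x, H' x⟫) {x g : V} (hx : H' x = g) : ‖x‖ ≤ ‖g‖ / c := by
  have h1 : c * ‖x‖ ^ 2 ≤ ‖x‖ * ‖g‖ := by
    calc c * ‖x‖ ^ 2 ≤ ⟪x, H' x⟫ := hcoer x
      _ = ⟪x, g⟫ := by rw [hx]
      _ ≤ ‖x‖ * ‖g‖ := real_inner_le_norm _ _
  rw [le_div_iff₀ hc]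
  rcases (norm_nonneg x).eq_or_lt with h0 | hpos
  · rw [← h0]; simp
  · have : c * ‖x‖ * ‖x‖ ≤ ‖g‖ * ‖x‖ := by nlinarith
    have := le_of_mul_le_mul_right this hpos
    linarith

/-- **WEIGHTED SOLUTION BOUND (Combes–Thomas).**  `H u = f`; `W` an invertible linear weight with inverse `Winv`
(`Winv (W v) = v`); if the conjugated operator `x ↦ W (H (Winv x))` is `c`-coercive, then `‖W u‖ ≤ ‖W f‖ ∕ c`.
Dictionary: `W` = multiplication by `e^{μρ}`, `ρ` the unit-scale distance to the cube of interest; for the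
block-mean-zero scalar Laplacian the conjugated coercivity comes from §1 with `a, b = O(μ)` (unit-scale Lipschitz
weight against a second-order difference operator — mesh-uniform), `m` = the block Poincaré gap. [folklore] -/
theorem weighted_solution_bound (H W Winv : V →ₗ[ℝ] V) (hinv : ∀ v, Winv (W v) = v) {c : ℝ} (hc : 0 < c)
    (hcoer : ∀ x, c * ‖x‖ ^ 2 ≤ ⟪x, W (H (Winv x))⟫) {u f : V} (hu : H u = f) :
    ‖W u‖ ≤ ‖W f‖ / c := by
  refine norm_le_of_coercive_eq (W ∘ₗ H ∘ₗ Winv) hc (fun x => by simpa using hcoer x) ?_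
  simp [hinv, hu]

/-- The same bound phrased for the inverse map: if `G` is a right inverse of `H` on the relevant vectors
(`H (G f) = f`), then `‖W (G f)‖ ≤ ‖W f‖ ∕ c`. [folklore] -/
theorem weighted_inverse_bound (H G W Winv : V →ₗ[ℝ] V) (hinv : ∀ v, Winv (W v) = v) {c : ℝ} (hc : 0 < c)
    (hcoer : ∀ x, c * ‖x‖ ^ 2 ≤ ⟪x, W (H (Winv x))⟫) (hG : ∀ f, H (G f) = f) (f : V) :
    ‖W (G f)‖ ≤ ‖W f‖ / c :=
  weighted_solution_bound H W Winv hinv hc hcoer (hG f)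

/-! ## §3 Weighted bound for a correction map `S ∘ G ∘ K` -/

/-- **WEIGHTED CORRECTION BOUND** (the shape of θ₁ ∕ κ₂ in the constrained Agmon bound).  A correction map of the
form `corr = S ∘ G ∘ K` — `K` reads the constraint∕gauge DEFECT of a test vector (dictionary: `K = Q_U ∘ [·, ω]` or
`R D*_U ∘ [·, ω]`, which is why its weighted norm carries the small factor `μ`), `G` inverts the gapped Gram
operator, `S` re-embeds (`Q_U*` or `D_U R*`) — satisfies `‖W (corr v)‖ ≤ C_S · (C_K ∕ c) · ‖W′ v‖` as soon as
`‖W (S y)‖ ≤ C_S ‖W₁ y‖`, `‖W₁ (G z)‖ ≤ ‖W₁ z‖ ∕ c` (§2) and `‖W₁ (K v)‖ ≤ C_K ‖W′ v‖`. [folklore] -/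
theorem weighted_correction_bound {V₁ V' : Type*} [NormedAddCommGroup V₁] [InnerProductSpace ℝ V₁]
    [NormedAddCommGroup V'] [InnerProductSpace ℝ V']
    (S : V₁ →ₗ[ℝ] V) (G : V₁ →ₗ[ℝ] V₁) (K : V' →ₗ[ℝ] V₁) (W : V →ₗ[ℝ] V) (W₁ : V₁ →ₗ[ℝ] V₁) (W' : V' →ₗ[ℝ] V')
    {CS CK c : ℝ} (hCS : 0 ≤ CS) (hc : 0 < c)
    (hS : ∀ y, ‖W (S y)‖ ≤ CS * ‖W₁ y‖) (hG : ∀ z, ‖W₁ (G z)‖ ≤ ‖W₁ z‖ / c)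
    (hK : ∀ v, ‖W₁ (K v)‖ ≤ CK * ‖W' v‖) (v : V') :
    ‖W (S (G (K v)))‖ ≤ CS * (CK / c) * ‖W' v‖ := by
  calc ‖W (S (G (K v)))‖ ≤ CS * ‖W₁ (G (K v))‖ := hS _
    _ ≤ CS * (‖W₁ (K v)‖ / c) := mul_le_mul_of_nonneg_left (hG _) hCS
    _ ≤ CS * (CK * ‖W' v‖ / c) := by
        apply mul_le_mul_of_nonneg_left _ hCS
        exact div_le_div_of_nonneg_right (hK v) hc.le
    _ = CS * (CK / c) * ‖W' v‖ := by ring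

/-- The two correction constants of the constrained Agmon bound are `O(μ)` once `C_K = C_K′ · μ` (the defect operator
`K` contains one commutator with the weight): `θ₁ := C_S · C_K′ · μ ∕ c`. Pure arithmetic, recorded for the assembly.
[folklore] -/
theorem correction_constant_linear_in_mu {CS CK' μ c : ℝ} (hc : 0 < c) :
    CS * (CK' * μ / c) = (CS * CK' / c) * μ := by
  field_simp

/-! ## §4 Non-vacuity on `ℝ` -/

namespace Witness

/-- On `ℝ` with `H = 3·id`, `W = 2·id`, `Winv = ½·id`: the conjugated operator is `3·id`, `3`-coercive, and for
`H u = f` (i.e. `u = f∕3`) the weighted bound reads `‖2u‖ ≤ ‖2f‖∕3` — attained. [folklore] -/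
theorem weighted_solution_witness (f : ℝ) :
    ‖((2 : ℝ) • LinearMap.id : ℝ →ₗ[ℝ] ℝ) (f / 3)‖ ≤ ‖((2 : ℝ) • LinearMap.id : ℝ →ₗ[ℝ] ℝ) f‖ / 3 := by
  have hinv : ∀ v : ℝ, ((1 / 2 : ℝ) • LinearMap.id : ℝ →ₗ[ℝ] ℝ) (((2 : ℝ) • LinearMap.id : ℝ →ₗ[ℝ] ℝ) v) = v := by
    intro v
    simp only [LinearMap.smul_apply, LinearMap.id_coe, id_eq, smul_eq_mul]
    ring
  have hcoer : ∀ x : ℝ, 3 * ‖x‖ ^ 2 ≤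
      ⟪x, ((2 : ℝ) • LinearMap.id : ℝ →ₗ[ℝ] ℝ) (((3 : ℝ) • LinearMap.id : ℝ →ₗ[ℝ] ℝ)
        (((1 / 2 : ℝ) • LinearMap.id : ℝ →ₗ[ℝ] ℝ) x))⟫ := by
    intro x
    have hx : ((2 : ℝ) • LinearMap.id : ℝ →ₗ[ℝ] ℝ) (((3 : ℝ) • LinearMap.id : ℝ →ₗ[ℝ] ℝ)
        (((1 / 2 : ℝ) • LinearMap.id : ℝ →ₗ[ℝ] ℝ) x)) = (3 : ℝ) • x := by
      simp only [LinearMap.smul_apply, LinearMap.id_coe, id_eq, smul_eq_mul]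
      ring
    rw [hx, real_inner_smul_right, real_inner_self_eq_norm_sq]
  have hu : ((3 : ℝ) • LinearMap.id : ℝ →ₗ[ℝ] ℝ) (f / 3) = f := by
    simp only [LinearMap.smul_apply, LinearMap.id_coe, id_eq, smul_eq_mul]
    ring
  exact weighted_solution_bound (V := ℝ) ((3 : ℝ) • LinearMap.id) ((2 : ℝ) • LinearMap.id)
    ((1 / 2 : ℝ) • LinearMap.id) hinv (c := 3) (by norm_num) hcoer hu

/-- §1 on numbers: gap `m = 2`, defect constants `a = 1∕2`, `b = 1∕4` leave the coercivity constant
`(1 − 1∕4)·2 − 1∕2 = 1`. [folklore] -/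
theorem conj_coercivity_witness : ((1 - (1/4 : ℝ)) * 2 - 1/2) = 1 := by norm_num

end Witness

end

end Summit.QuantumFields.BalabanUV.T4Continuum.NE3ProjectorLocality
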